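import Literature.Computability.Complexity.StockmeyerEstimator
import Literature.Computability.Cryptography.LeftoverHashLemma
import HarnessLib

/-!
# Affine hashing keyed by bit strings: the string-keyed family as a pairwise independent family

`AffineHashing.lean` proves that `h_{A,b}(y) = A y + b` over `𝔽₂` is pairwise independent
(Arora–Barak 2009, Def. 8.14 / Exercise 8.4), and `StockmeyerEstimator.lean` already reads such a
hash off a **bit string** `u`: `Stockmeyer.coinHash u m k` (row `j` = bits `j(m+1) … j(m+1)+m-1`,
offset bit `j(m+1)+m`; surplus bits ignored), with the bit-level evaluation `Stockmeyer.rowParity`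
(`hash_coinHash_apply`) and equal fibres of the reading map (`card_filter_coinHash`, any key length
`ℓ ≥ k(m+1)`). Cryptographic consumers (Liu–Pass 2020, Lemma 5.3: the hash functions `h_{σ₁}`,
`h_{σ₂}` "described by strings `σ` of `n^c` bits", Carter–Wegman 1979) need this family in the
format of `LeftoverHashLemma.lean` (`LeftoverHash.IsPairwiseIndep`, keys a `Finset`, points in a
`Finset`). This file is that (thin) bridge — no new layout:

* `hashV m k σ x = A_σ x + b_σ ∈ 𝔽₂^k` for `x ∈ {0,1}^m` (`= hash (coinHash σ m k) (toZ x)`);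
* **pairwise independence keyed by strings** (`isPairwiseIndep_hashV`): for every `ℓ ≥ k(m+1)` and
  every `S ⊆ {0,1}^m`, `#{σ ∈ {0,1}^ℓ : h_σ x = y ∧ h_σ x' = y'} · 4^k = 2^ℓ` for `x ≠ x'` in `S`;
* the hash value as a bit string: `encZ` (injective), `hashStr m k σ x = [rowParity σ m (x ↾ m) j]_{j<k}`
  (total in `x`; `hashStr_toList`: on `x ∈ {0,1}^m` it is `encZ (hashV m k σ x)`), `|hashStr| = k`.

All statements proved. The polynomial-time evaluation of `hashStr` is `AffineHashProgram.lean`.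

## References

* J. L. Carter, M. N. Wegman, *Universal classes of hash functions*, JCSS 18 (1979) 143–154.
* S. Arora, B. Barak, *Computational Complexity: A Modern Approach*, CUP 2009, Def. 8.14 (p. 185),
  Thm. 8.15, Exercise 8.4 (p. 204) (pairwise independent hash families; the affine family).
* Y. Liu, R. Pass, *On one-way functions and Kolmogorov complexity*, FOCS 2020
  (arXiv:2009.11514), Appendix (Def. universal hash family described by `n^c`-bit strings;
  Lemma [car79]).
-/

namespace Literature.Computability.Cryptography

namespace AffineStr

open Finset Complexity Complexity.AffineHash Complexity.Stockmeyer

/-! ### The family on `{0,1}^m`, keyed by strings -/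

/-- **The string-keyed affine hash** `hashV m k σ x = A_σ x + b_σ ∈ 𝔽₂^k`, the key `(A_σ, b_σ)`
read off `σ` in the layout of `Stockmeyer.coinHash` (row `j` at bits `j(m+1) … j(m+1)+m`).
[Arora–Barak 2009, Def. 8.14 with Exercise 8.4; Carter–Wegman 1979]
[cite: AroraBarakCC2009, Def. 8.14 (p. 185) with Exercise 8.4 (p. 204)] -/
def hashV (m k : ℕ) (σ : List Bool) (x : List.Vector Bool m) : Fin k → ZMod 2 :=
  hash (coinHash σ m k) (toZ x)

/-- `|Hash m k| > 0`. [folklore] -/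
theorem card_hash_pos (m k : ℕ) : 0 < Fintype.card (Hash m k) := Fintype.card_pos

/-- **Pairwise independence of affine hashing keyed by strings.** For `ℓ ≥ k(m+1)` and every
`S ⊆ {0,1}^m`, the family `(σ, x) ↦ A_σ x + b_σ` with `σ` uniform in `{0,1}^ℓ` is pairwise
independent on `S` in the sense of `LeftoverHash.IsPairwiseIndep`:
`#{σ : h_σ x = y ∧ h_σ x' = y'} · (2^k)² = 2^ℓ` for `x ≠ x'` (equal fibres of the reading map,
`card_filter_coinHash`, and pairwise independence of `(A, b)`, `card_filter_hash_pair`).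
[Arora–Barak 2009, Def. 8.14 / Exercise 8.4; Carter–Wegman 1979]
[cite: AroraBarakCC2009, Def. 8.14 (p. 185) with Exercise 8.4 (p. 204)] -/
theorem isPairwiseIndep_hashV {m k ℓ : ℕ} (hℓ : k * (m + 1) ≤ ℓ) (S : Finset (List.Vector Bool m)) :
    LeftoverHash.IsPairwiseIndep (Finset.univ : Finset (List.Vector Bool ℓ)) (fun σ x => hashV m k σ.toList x) S := by
  intro x _ x' _ hne y y'
  have hX : toZ x ≠ toZ x' := fun h => hne (toZ_injective h)
  -- the two counting facts, restated with this file's (constructive) decidability instances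
  -- (`StockmeyerEstimator.lean` works under `open scoped Classical`)
  have hpair : (univ.filter fun h : Hash m k => hash h (toZ x) = y ∧ hash h (toZ x') = y').card * (2 ^ k * 2 ^ k) =
      Fintype.card (Hash m k) := by
    convert card_filter_hash_pair (k := k) hX y y' using 4
  have hfib : (univ.filter fun σ : List.Vector Bool ℓ => hash (coinHash σ.toList m k) (toZ x) = y ∧
        hash (coinHash σ.toList m k) (toZ x') = y').card * Fintype.card (Hash m k) =
      (univ.filter fun h : Hash m k => hash h (toZ x) = y ∧ hash h (toZ x') = y').card * 2 ^ ℓ := by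
    convert card_filter_coinHash hℓ (fun h : Hash m k => hash h (toZ x) = y ∧ hash h (toZ x') = y') using 4
  have hγ : Fintype.card (Fin k → ZMod 2) = 2 ^ k := by rw [Fintype.card_fun, ZMod.card, Fintype.card_fin]
  have hH := card_hash_pos m k
  rw [hγ, Finset.card_univ, card_vector, Fintype.card_bool, sq]
  show (univ.filter fun σ : List.Vector Bool ℓ => hash (coinHash σ.toList m k) (toZ x) = y ∧
      hash (coinHash σ.toList m k) (toZ x') = y').card * (2 ^ k * 2 ^ k) = 2 ^ ℓ
  -- cancel `|Hash m k|`
  generalize (univ.filter fun h : Hash m k => hash h (toZ x) = y ∧ hash h (toZ x') = y').card = P at hpair hfib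
  generalize (univ.filter fun σ : List.Vector Bool ℓ => hash (coinHash σ.toList m k) (toZ x) = y ∧
    hash (coinHash σ.toList m k) (toZ x') = y').card = N at hfib ⊢
  refine Nat.eq_of_mul_eq_mul_right hH ?_
  calc N * (2 ^ k * 2 ^ k) * Fintype.card (Hash m k) = (N * Fintype.card (Hash m k)) * (2 ^ k * 2 ^ k) := by ring
    _ = P * 2 ^ ℓ * (2 ^ k * 2 ^ k) := by rw [hfib]
    _ = (P * (2 ^ k * 2 ^ k)) * 2 ^ ℓ := by ring
    _ = 2 ^ ℓ * Fintype.card (Hash m k) := by rw [hpair, Nat.mul_comm]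

/-! ### Hash values as bit strings -/

/-- A vector over `𝔽₂` as a bit string. [folklore] -/
def encZ (k : ℕ) (y : Fin k → ZMod 2) : List Bool := List.ofFn fun i => decide (y i = 1)

/-- `|encZ y| = k`. [folklore] -/
@[simp] theorem length_encZ (k : ℕ) (y : Fin k → ZMod 2) : (encZ k y).length = k := by simp [encZ]

/-- `bz` inverts `z ↦ [z = 1]` on `𝔽₂` (cf. `Stockmeyer.boolEquivZ`). [folklore] -/
@[simp] theorem bz_decide (z : ZMod 2) : bz (decide (z = 1)) = z := by
  fin_cases z <;> rfl

/-- `encZ` is injective. [folklore] -/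
theorem encZ_injective (k : ℕ) : Function.Injective (encZ k) := by
  intro y y' h
  funext i
  have := congrArg (fun l => l.getD i false) h
  simp only [encZ, List.getD_eq_getElem?_getD, List.getElem?_ofFn, Fin.is_lt] at this
  have hd : decide (y i = 1) = decide (y' i = 1) := by simpa using this
  rw [← bz_decide (y i), ← bz_decide (y' i), hd]

/-- **The hash value as a bit string**, total in `x`: row `j < k` contributes
`rowParity σ m (x ↾ m) j` (parity of the row's matrix bits `AND` the first `m` bits of `x`, `XOR`
the offset bit — what a machine computes, `Stockmeyer.rowParity`). [Carter–Wegman 1979;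
Arora–Barak 2009, Exercise 8.4] [cite: AroraBarakCC2009, Def. 8.14 (p. 185) with Exercise 8.4 (p. 204)] -/
def hashStr (m k : ℕ) (σ x : List Bool) : List Bool := (List.range k).map (rowParity σ m (x.take m))

/-- `|hashStr m k σ x| = k`. [folklore] -/
@[simp] theorem length_hashStr (m k : ℕ) (σ x : List Bool) : (hashStr m k σ x).length = k := by simp [hashStr]

/-- `bz c = 1 ↔ c`. [folklore] -/
@[simp] theorem bz_eq_one_iff (c : Bool) : bz c = 1 ↔ c = true := by
  cases c <;> decide

/-- **On `x ∈ {0,1}^m` the bit string is the encoded `𝔽₂`-hash**: `hashStr m k σ x = encZ (hashV m k σ x)`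
(by `hash_coinHash_apply`). [folklore] -/
theorem hashStr_toList (m k : ℕ) (σ : List Bool) (x : List.Vector Bool m) :
    hashStr m k σ x.toList = encZ k (hashV m k σ x) := by
  unfold hashStr encZ hashV
  rw [List.ofFn_eq_map, ← List.map_coe_finRange_eq_range, List.map_map,
    List.take_of_length_le (le_of_eq (List.Vector.toList_length x))]
  refine List.map_congr_left fun i _ => ?_
  simp only [Function.comp_apply, hash_coinHash_apply, bz_eq_one_iff, Bool.decide_eq_true]

end AffineStr

end Literature.Computability.Cryptography
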